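import Summits.CriticalPhenomena.PercolationContinuityZ3.Theorems.Transplant.FKConnectivityAllQPat3MinorCone
import HarnessLib

/-!
# Connectivity correlation inequalities for `φ_{w,q}`, every `q > 0` — THE TWO-PIECE PRODUCT CONE (`pairSumC`, census g36/g37's
# triple-sum machinery for t = 2; census g39 §3 leaf VEE\*, §11 (ii))

Definitions + theorems file (`--supports stmt-CriticalPhenomena-4575`), census lineage (gen 40) of LANE 2's FK sub-programme; builds on
p205010 (kernel theorem, internal audit signed; external expert review pending).  No named facts, no sorries; standard axioms.

* `FK.Prod2` (multiplier, shift, one two-level generator per piece), `FK.Prod2.tensor` (+ vanishing above `shift + 2`);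
* **`FK.pairSumC E₁ C₁ E₂ C₂ u₁ v₁ m₁ u₂ v₂ m₂ X`** (noncomputable) — the two-piece analogue of `FK.tripleSumC`: the sum over the
  colourings `γ₁ ⊆ E₁, γ₂ ⊆ E₂` of `X` at the two contracted exponents and the four piece patterns; flips
  (`FK.pairSumC_flip1/2`), linearity (`_add`, `_const_mul`, `_finset_sum`), monotonicity (`_mono`), and the fourfold
  symmetrisation `FK.symm4` with **`FK.pairSumC_symm4`** (`pairSumC (symm4 X) = 4 · pairSumC X`);
* `FK.bterm2` (a product as an `X`-term), `FK.bterm2_eq_tensor`, `FK.bterm2_eq_zero`, and **`FK.pairSumC_bterm2_nonneg`**: a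
  product of generators levelwise nonnegative on the two piece minors has nonnegative pair sum (two `FK.regroup1C`).
[cite: Grimmett2006, §1.4 eq. (1.20) (p. 15); §3.8 (pp. 61–62)] [cite: AyyerLinussonRavichandran2025, §7 (p. 22)]
-/

namespace Summit.CriticalPhenomena.PercolationContinuityZ3.Theorems

namespace FK

open SimpleGraph Literature.Probability.LatticeModels Literature.Probability.Percolation
open scoped Classical

variable {V : Type*}

/-! ### The two-piece analogue of census g36/g37's triple-sum machinery (for the t = 2 leaves, e.g. VEE*) -/

section PairCone

/-- One product of a TWO-piece product-cone certificate: multiplier, level shift, one two-level generator per piece. [folklore] -/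
structure Prod2 where
  /-- numerator of the multiplier -/
  lam : ℕ
  /-- level shift of the product -/
  shift : ℕ
  /-- generator on the first piece -/
  g1 : ℕ → Pat3 → Pat3 → ℤ
  /-- generator on the second piece -/
  g2 : ℕ → Pat3 → Pat3 → ℤ

/-- The tensor of a two-piece product at residual level `d`: `Σ_{c1+c2+κ = d} g1 g2`. [folklore] -/
def Prod2.tensor (p : Prod2) (d : ℕ) (P1 Q1 P2 Q2 : Pat3) : ℤ :=
  ∑ c1 ∈ Finset.range 2, ∑ c2 ∈ Finset.range 2, if c1 + c2 + p.shift = d then p.g1 c1 P1 Q1 * p.g2 c2 P2 Q2 else 0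

/-- A product with shift `≤ B` has no tensor entries at residual levels `≥ B + 4`. [folklore] -/
theorem Prod2.tensor_eq_zero_of_le (p : Prod2) {B : ℕ} (hp : p.shift ≤ B) {d : ℕ} (hd : B + 4 ≤ d) (P1 Q1 P2 Q2 : Pat3) :
    p.tensor d P1 Q1 P2 Q2 = 0 := by
  unfold Prod2.tensor
  refine Finset.sum_eq_zero fun c1 hc1 => Finset.sum_eq_zero fun c2 hc2 => ?_
  rw [Finset.mem_range] at hc1 hc2
  have : ¬ (c1 + c2 + p.shift = d) := by omega
  rw [if_neg this]

open scoped Classical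

/-- The sum over configuration PAIRS of two piece minors of a term depending on the levels and the pattern pairs. [folklore] -/
noncomputable def pairSumC (E₁ C₁ E₂ C₂ : Finset (Sym2 V)) (u₁ v₁ m₁ u₂ v₂ m₂ : V) (X : ℕ → ℕ → Pat3 → Pat3 → Pat3 → Pat3 → ℤ) : ℤ :=
  ∑ γ₁ ∈ E₁.powerset, ∑ γ₂ ∈ E₂.powerset,
    X (apExpC E₁ C₁ γ₁) (apExpC E₂ C₂ γ₂) (pat3 (γ₁ ∪ C₁) u₁ v₁ m₁) (pat3 (E₁ \ γ₁ ∪ C₁) u₁ v₁ m₁)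
      (pat3 (γ₂ ∪ C₂) u₂ v₂ m₂) (pat3 (E₂ \ γ₂ ∪ C₂) u₂ v₂ m₂)

variable (E₁ C₁ E₂ C₂ : Finset (Sym2 V)) (u₁ v₁ m₁ u₂ v₂ m₂ : V)

/-- Flip of the first piece inside a pair sum. [folklore] -/
theorem pairSumC_flip1 (X : ℕ → ℕ → Pat3 → Pat3 → Pat3 → Pat3 → ℤ) :
    pairSumC E₁ C₁ E₂ C₂ u₁ v₁ m₁ u₂ v₂ m₂ X =
      pairSumC E₁ C₁ E₂ C₂ u₁ v₁ m₁ u₂ v₂ m₂ (fun e1 e2 P1 Q1 P2 Q2 => X e1 e2 Q1 P1 P2 Q2) := by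
  unfold pairSumC
  exact sum_powerset_flip3C E₁ C₁ u₁ v₁ m₁ (fun e1 P1 Q1 => ∑ γ₂ ∈ E₂.powerset,
    X e1 (apExpC E₂ C₂ γ₂) P1 Q1 (pat3 (γ₂ ∪ C₂) u₂ v₂ m₂) (pat3 (E₂ \ γ₂ ∪ C₂) u₂ v₂ m₂))

/-- Flip of the second piece inside a pair sum. [folklore] -/
theorem pairSumC_flip2 (X : ℕ → ℕ → Pat3 → Pat3 → Pat3 → Pat3 → ℤ) :
    pairSumC E₁ C₁ E₂ C₂ u₁ v₁ m₁ u₂ v₂ m₂ X =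
      pairSumC E₁ C₁ E₂ C₂ u₁ v₁ m₁ u₂ v₂ m₂ (fun e1 e2 P1 Q1 P2 Q2 => X e1 e2 P1 Q1 Q2 P2) := by
  unfold pairSumC
  refine Finset.sum_congr rfl fun γ₁ _ => ?_
  exact sum_powerset_flip3C E₂ C₂ u₂ v₂ m₂ (fun e2 P2 Q2 =>
    X (apExpC E₁ C₁ γ₁) e2 (pat3 (γ₁ ∪ C₁) u₁ v₁ m₁) (pat3 (E₁ \ γ₁ ∪ C₁) u₁ v₁ m₁) P2 Q2)

/-- Additivity of the pair sum. [folklore] -/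
theorem pairSumC_add (X X' : ℕ → ℕ → Pat3 → Pat3 → Pat3 → Pat3 → ℤ) :
    pairSumC E₁ C₁ E₂ C₂ u₁ v₁ m₁ u₂ v₂ m₂ (fun e1 e2 P1 Q1 P2 Q2 => X e1 e2 P1 Q1 P2 Q2 + X' e1 e2 P1 Q1 P2 Q2) =
      pairSumC E₁ C₁ E₂ C₂ u₁ v₁ m₁ u₂ v₂ m₂ X + pairSumC E₁ C₁ E₂ C₂ u₁ v₁ m₁ u₂ v₂ m₂ X' := by
  unfold pairSumC
  simp only [Finset.sum_add_distrib]

/-- Homogeneity of the pair sum. [folklore] -/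
theorem pairSumC_const_mul (c : ℤ) (X : ℕ → ℕ → Pat3 → Pat3 → Pat3 → Pat3 → ℤ) :
    pairSumC E₁ C₁ E₂ C₂ u₁ v₁ m₁ u₂ v₂ m₂ (fun e1 e2 P1 Q1 P2 Q2 => c * X e1 e2 P1 Q1 P2 Q2) =
      c * pairSumC E₁ C₁ E₂ C₂ u₁ v₁ m₁ u₂ v₂ m₂ X := by
  unfold pairSumC
  simp only [Finset.mul_sum]

/-- The pair sum commutes with finite sums of terms. [folklore] -/
theorem pairSumC_finset_sum {ι : Type*} (J : Finset ι) (X : ι → ℕ → ℕ → Pat3 → Pat3 → Pat3 → Pat3 → ℤ) :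
    pairSumC E₁ C₁ E₂ C₂ u₁ v₁ m₁ u₂ v₂ m₂ (fun e1 e2 P1 Q1 P2 Q2 => ∑ j ∈ J, X j e1 e2 P1 Q1 P2 Q2) =
      ∑ j ∈ J, pairSumC E₁ C₁ E₂ C₂ u₁ v₁ m₁ u₂ v₂ m₂ (X j) := by
  unfold pairSumC
  symm
  rw [Finset.sum_comm]
  refine Finset.sum_congr rfl fun γ₁ _ => ?_
  rw [Finset.sum_comm]

/-- Monotonicity of the pair sum. [folklore] -/
theorem pairSumC_mono {X X' : ℕ → ℕ → Pat3 → Pat3 → Pat3 → Pat3 → ℤ}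
    (h : ∀ e1 e2 P1 Q1 P2 Q2, X e1 e2 P1 Q1 P2 Q2 ≤ X' e1 e2 P1 Q1 P2 Q2) :
    pairSumC E₁ C₁ E₂ C₂ u₁ v₁ m₁ u₂ v₂ m₂ X ≤ pairSumC E₁ C₁ E₂ C₂ u₁ v₁ m₁ u₂ v₂ m₂ X' := by
  unfold pairSumC
  exact Finset.sum_le_sum fun _ _ => Finset.sum_le_sum fun _ _ => h ..

/-- The fourfold flip-symmetrisation of a pair term. [folklore] -/
def symm4 (X : ℕ → ℕ → Pat3 → Pat3 → Pat3 → Pat3 → ℤ) : ℕ → ℕ → Pat3 → Pat3 → Pat3 → Pat3 → ℤ :=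
  fun e1 e2 P1 Q1 P2 Q2 =>
    X e1 e2 P1 Q1 P2 Q2 + X e1 e2 Q1 P1 P2 Q2 + (X e1 e2 P1 Q1 Q2 P2 + X e1 e2 Q1 P1 Q2 P2)

/-- **Four copies of a pair sum are the pair sum of the symmetrised term.** [folklore] -/
theorem pairSumC_symm4 (X : ℕ → ℕ → Pat3 → Pat3 → Pat3 → Pat3 → ℤ) :
    4 * pairSumC E₁ C₁ E₂ C₂ u₁ v₁ m₁ u₂ v₂ m₂ X = pairSumC E₁ C₁ E₂ C₂ u₁ v₁ m₁ u₂ v₂ m₂ (symm4 X) := by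
  set Y1 : ℕ → ℕ → Pat3 → Pat3 → Pat3 → Pat3 → ℤ :=
    fun e1 e2 P1 Q1 P2 Q2 => X e1 e2 P1 Q1 P2 Q2 + X e1 e2 Q1 P1 P2 Q2 with hY1
  have h1 : pairSumC E₁ C₁ E₂ C₂ u₁ v₁ m₁ u₂ v₂ m₂ Y1 = 2 * pairSumC E₁ C₁ E₂ C₂ u₁ v₁ m₁ u₂ v₂ m₂ X := by
    rw [hY1, pairSumC_add, ← pairSumC_flip1]; ring
  set Y2 : ℕ → ℕ → Pat3 → Pat3 → Pat3 → Pat3 → ℤ :=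
    fun e1 e2 P1 Q1 P2 Q2 => Y1 e1 e2 P1 Q1 P2 Q2 + Y1 e1 e2 P1 Q1 Q2 P2 with hY2
  have h2 : pairSumC E₁ C₁ E₂ C₂ u₁ v₁ m₁ u₂ v₂ m₂ Y2 = 2 * pairSumC E₁ C₁ E₂ C₂ u₁ v₁ m₁ u₂ v₂ m₂ Y1 := by
    rw [hY2, pairSumC_add, ← pairSumC_flip2]; ring
  have hY : Y2 = symm4 X := by
    funext e1 e2 P1 Q1 P2 Q2
    simp only [hY2, hY1, symm4]
  rw [← hY, h2, h1]; ring

/-- The product-side term of a two-piece product at the levels `e₁, e₂` (top level `N`). [folklore] -/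
def bterm2 (p : Prod2) (N : ℕ) : ℕ → ℕ → Pat3 → Pat3 → Pat3 → Pat3 → ℤ :=
  fun e1 e2 P1 Q1 P2 Q2 =>
    ∑ c1 ∈ Finset.range 2, ∑ c2 ∈ Finset.range 2,
      (if e1 + e2 + (c1 + c2 + p.shift) = N then p.g1 c1 P1 Q1 * p.g2 c2 P2 Q2 else 0)

/-- The product-side term is the product tensor at the residual level. [folklore] -/
theorem bterm2_eq_tensor (p : Prod2) {N e1 e2 d : ℕ} (hd : e1 + e2 + d = N) (P1 Q1 P2 Q2 : Pat3) :
    bterm2 p N e1 e2 P1 Q1 P2 Q2 = p.tensor d P1 Q1 P2 Q2 := by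
  unfold bterm2 Prod2.tensor
  refine Finset.sum_congr rfl fun c1 _ => Finset.sum_congr rfl fun c2 _ => ?_
  split_ifs <;> first | rfl | (exfalso; omega)

/-- Beyond the top level the product-side term vanishes. [folklore] -/
theorem bterm2_eq_zero (p : Prod2) {N e1 e2 : ℕ} (hlt : N < e1 + e2) (P1 Q1 P2 Q2 : Pat3) :
    bterm2 p N e1 e2 P1 Q1 P2 Q2 = 0 := by
  unfold bterm2
  refine Finset.sum_eq_zero fun c1 _ => Finset.sum_eq_zero fun c2 _ => ?_
  have : ¬ (e1 + e2 + (c1 + c2 + p.shift) = N) := by omega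
  rw [if_neg this]

/-- **The product side is nonnegative** (two regroupings by `FK.regroup1C`). [folklore] -/
theorem pairSumC_bterm2_nonneg (p : Prod2) (N : ℕ)
    (hp : ∀ μ : ℕ, 0 ≤ lev2C E₁ C₁ u₁ v₁ m₁ p.g1 μ ∧ 0 ≤ lev2C E₂ C₂ u₂ v₂ m₂ p.g2 μ) :
    0 ≤ pairSumC E₁ C₁ E₂ C₂ u₁ v₁ m₁ u₂ v₂ m₂ (bterm2 p N) := by
  unfold pairSumC bterm2
  have E01 : ∑ γ₁ ∈ E₁.powerset, ∑ γ₂ ∈ E₂.powerset, ∑ c1 ∈ Finset.range 2, ∑ c2 ∈ Finset.range 2,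
        (if apExpC E₁ C₁ γ₁ + apExpC E₂ C₂ γ₂ + (c1 + c2 + p.shift) = N then
          p.g1 c1 (pat3 (γ₁ ∪ C₁) u₁ v₁ m₁) (pat3 (E₁ \ γ₁ ∪ C₁) u₁ v₁ m₁) *
            p.g2 c2 (pat3 (γ₂ ∪ C₂) u₂ v₂ m₂) (pat3 (E₂ \ γ₂ ∪ C₂) u₂ v₂ m₂) else 0) =
      ∑ γ₁ ∈ E₁.powerset, ∑ c1 ∈ Finset.range 2, ∑ μ2 ∈ Finset.range (N + 1),
        (if μ2 + (apExpC E₁ C₁ γ₁ + c1 + p.shift) = N then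
          lev2C E₂ C₂ u₂ v₂ m₂ p.g2 μ2 * p.g1 c1 (pat3 (γ₁ ∪ C₁) u₁ v₁ m₁) (pat3 (E₁ \ γ₁ ∪ C₁) u₁ v₁ m₁) else 0) := by
    refine Finset.sum_congr rfl fun γ₁ _ => ?_
    rw [Finset.sum_comm]
    refine Finset.sum_congr rfl fun c1 _ => ?_
    rw [← regroup1C E₂ C₂ u₂ v₂ m₂ p.g2 N (apExpC E₁ C₁ γ₁ + c1 + p.shift)]
    refine Finset.sum_congr rfl fun γ₂ _ => Finset.sum_congr rfl fun c2 _ => ?_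
    exact ite_eq_ite_of_iff (by constructor <;> intro h <;> omega) (by ring)
  have E12 : ∑ γ₁ ∈ E₁.powerset, ∑ c1 ∈ Finset.range 2, ∑ μ2 ∈ Finset.range (N + 1),
        (if μ2 + (apExpC E₁ C₁ γ₁ + c1 + p.shift) = N then
          lev2C E₂ C₂ u₂ v₂ m₂ p.g2 μ2 * p.g1 c1 (pat3 (γ₁ ∪ C₁) u₁ v₁ m₁) (pat3 (E₁ \ γ₁ ∪ C₁) u₁ v₁ m₁) else 0) =
      ∑ μ2 ∈ Finset.range (N + 1), ∑ μ1 ∈ Finset.range (N + 1),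
        (if μ1 + (μ2 + p.shift) = N then lev2C E₁ C₁ u₁ v₁ m₁ p.g1 μ1 * lev2C E₂ C₂ u₂ v₂ m₂ p.g2 μ2 else 0) := by
    rw [Finset.sum_congr rfl fun γ₁ _ => Finset.sum_comm, Finset.sum_comm]
    refine Finset.sum_congr rfl fun μ2 _ => ?_
    rw [← regroup1C E₁ C₁ u₁ v₁ m₁ p.g1 N (μ2 + p.shift)]
    refine Finset.sum_congr rfl fun γ₁ _ => Finset.sum_congr rfl fun c1 _ => ?_
    exact ite_eq_ite_of_iff (by constructor <;> intro h <;> omega) (by ring)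
  rw [E01, E12]
  refine Finset.sum_nonneg fun μ2 _ => Finset.sum_nonneg fun μ1 _ => ?_
  split_ifs
  · exact mul_nonneg (hp μ1).1 (hp μ2).2
  · exact le_rfl

/-- From the list form of a two-piece certificate to the `Finset`-indexed form. [folklore] -/
theorem list_sum_eq_finset_sum2 (prods : List Prod2) (f : Prod2 → ℤ) :
    (prods.map f).sum = ∑ j : Fin prods.length, f (prods.get j) := by
  have h1 : prods.map f = List.ofFn (f ∘ prods.get) := by
    rw [← List.map_ofFn, List.ofFn_get]
  rw [h1, List.sum_ofFn]
  rfl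

end PairCone

end FK

end Summit.CriticalPhenomena.PercolationContinuityZ3.Theorems
-- build-touch 2026-08-25T18:27Z T1-D (lead g18): re-land of p399786, declarations byte-identical
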